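import Literature.Probability.RandomPlanarGeometry.HammersleyWelshBound
import Mathlib.Analysis.SpecificLimits.Basic
import HarnessLib

/-!
# The bridge generating function `∑ₙ bₙ xⁿ` of `ℤ²` is finite exactly below `x_c = 1/μ`

Topic `Literature/Probability/RandomPlanarGeometry`; a leaf next to `HammersleyWelshBound.lean`
(whose PROVED `DKY2014_eq21_holds : ∃ c, ∀ n, e^{-c√n} μⁿ ≤ bₙ ≤ μⁿ`, the Hammersley–Welsh bounds
for the Walk-bridges `SAW.bridgeCount n = bₙ` of `SupercriticalSAWPolygons.lean`, is the input)
and `SelfAvoidingWalk.lean` (`SAW.criticalFugacity = x_c = μ⁻¹`). Source: N. Madras, G. Slade,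
*The Self-Avoiding Walk* (1993), §1.2, (1.2.15)–(1.2.17) and Corollary 3.1.6: `μ_Bridge = μ`,
i.e. the bridge generating function has the same radius of convergence `1/μ` as the
susceptibility.

## Contents (all PROVED)

* `bridgeSeries_ne_top_of_lt_criticalFugacity` — `∑ₙ bₙ xⁿ < ∞` for `0 ≤ x < x_c`
  (`bₙ ≤ μⁿ`: comparison with the geometric series `∑ (μx)ⁿ`);
* `bridgeSeries_eq_top_of_criticalFugacity_lt` — `∑ₙ bₙ xⁿ = ∞` for `x > x_c`
  (`bₙ xⁿ ≥ e^{-c√n} (μx)ⁿ ≥ 1` eventually, so the terms do not tend to `0`);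
* `sSup_bridgeSeries_ne_top` — hence `sup {x ≥ 0 | ∑ₙ bₙ xⁿ < ∞} = x_c`: the radius of
  finiteness of the bridge generating function is the critical fugacity. This is the `s = 0`
  sanity value `x(0) = x_c` of the critical curve `SAW.criticalTilt` of
  `FrontierTiltedSAWLaw.lean` (`criticalTilt_zero_eq` there reduces `x(0)` to this supremum).

The series is taken in `ℝ≥0∞` (`∑' n, ENNReal.ofReal (x ^ n) * bₙ`), the form used by
`SAW.tiltedBridgeSeries`.
-/

noncomputable section

open Filter Topology Literature.Probability.LatticeModels Literature.Probability.Percolation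
open scoped ENNReal

namespace Literature.Probability.RandomPlanarGeometry.SAW

/-- The planar connective constant is positive (`μ ≥ 1`). [cite: MadrasSlade1993, §1.2] -/
theorem planar_connectiveConstant_pos : 0 < connectiveConstant := by
  have h := Zd.connectiveConstant_pos 2
  rwa [Zd.connectiveConstant_two] at h

/-- The planar critical fugacity `x_c = 1/μ` is positive. [cite: MadrasSlade1993, §1.2] -/
theorem criticalFugacity_pos : 0 < criticalFugacity := by
  rw [criticalFugacity]
  exact inv_pos.mpr planar_connectiveConstant_pos

/-- **Below `x_c` the bridge generating function is finite**: for `0 ≤ x < x_c = 1/μ`,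
`∑ₙ bₙ xⁿ ≤ ∑ₙ (μx)ⁿ < ∞` since `bₙ ≤ μⁿ` (Madras–Slade (1.2.17)).
[cite: MadrasSlade1993, §1.2, eq. (1.2.17)] -/
theorem bridgeSeries_ne_top_of_lt_criticalFugacity {x : ℝ} (hx0 : 0 ≤ x)
    (hx : x < criticalFugacity) :
    (∑' n : ℕ, ENNReal.ofReal (x ^ n) * (bridgeCount n : ℝ≥0∞)) ≠ ⊤ := by
  have hμ := planar_connectiveConstant_pos
  have hr : x * connectiveConstant < 1 := by
    rw [criticalFugacity] at hx
    calc x * connectiveConstant < connectiveConstant⁻¹ * connectiveConstant :=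
        mul_lt_mul_of_pos_right hx hμ
      _ = 1 := inv_mul_cancel₀ hμ.ne'
  have hle : ∀ n : ℕ, ENNReal.ofReal (x ^ n) * (bridgeCount n : ℝ≥0∞) ≤
      ENNReal.ofReal (x * connectiveConstant) ^ n := by
    intro n
    rw [← ENNReal.ofReal_natCast, ← ENNReal.ofReal_mul (pow_nonneg hx0 n),
      ← ENNReal.ofReal_pow (mul_nonneg hx0 hμ.le), mul_pow]
    exact ENNReal.ofReal_le_ofReal
      (mul_le_mul_of_nonneg_left (bridgeCount_le_pow n) (pow_nonneg hx0 n))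
  refine ne_top_of_le_ne_top ?_ (ENNReal.tsum_le_tsum hle)
  rw [ENNReal.tsum_geometric]
  exact ENNReal.inv_ne_top.mpr (tsub_pos_of_lt (ENNReal.ofReal_lt_one.mpr hr)).ne'

/-- **Above `x_c` the bridge generating function is infinite**: for `x > x_c`, the
Hammersley–Welsh lower bound `bₙ ≥ e^{-c√n} μⁿ` gives `bₙ xⁿ ≥ e^{n log(μx) - c√n} ≥ 1` for all
large `n`, so the terms do not tend to `0`. [cite: MadrasSlade1993, Corollary 3.1.6] -/
theorem bridgeSeries_eq_top_of_criticalFugacity_lt {x : ℝ} (hx : criticalFugacity < x) :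
    (∑' n : ℕ, ENNReal.ofReal (x ^ n) * (bridgeCount n : ℝ≥0∞)) = ⊤ := by
  obtain ⟨c, hc⟩ := DKY2014_eq21_holds
  have hμ := planar_connectiveConstant_pos
  have hx0 : 0 < x := criticalFugacity_pos.trans hx
  set r := x * connectiveConstant with hr
  have hr1 : 1 < r := by
    rw [criticalFugacity] at hx
    calc (1 : ℝ) = connectiveConstant⁻¹ * connectiveConstant := (inv_mul_cancel₀ hμ.ne').symm
      _ < x * connectiveConstant := mul_lt_mul_of_pos_right hx hμ
  have hlog : 0 < Real.log r := Real.log_pos hr1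
  -- eventually the terms are `≥ 1`
  have hev : ∀ᶠ n : ℕ in atTop,
      (1 : ℝ≥0∞) ≤ ENNReal.ofReal (x ^ n) * (bridgeCount n : ℝ≥0∞) := by
    refine eventually_atTop.2 ⟨⌈(c / Real.log r) ^ 2⌉₊, fun n hn => ?_⟩
    have hn' : (c / Real.log r) ^ 2 ≤ n := (Nat.le_ceil _).trans (by exact_mod_cast hn)
    have hsq : c / Real.log r ≤ Real.sqrt n :=
      calc c / Real.log r ≤ |c / Real.log r| := le_abs_self _
        _ = Real.sqrt ((c / Real.log r) ^ 2) := (Real.sqrt_sq_eq_abs _).symm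
        _ ≤ Real.sqrt n := Real.sqrt_le_sqrt hn'
    have hcn : c * Real.sqrt n ≤ n * Real.log r := by
      have h1 : c ≤ Real.sqrt n * Real.log r := by rwa [div_le_iff₀ hlog] at hsq
      calc c * Real.sqrt n ≤ (Real.sqrt n * Real.log r) * Real.sqrt n :=
          mul_le_mul_of_nonneg_right h1 (Real.sqrt_nonneg _)
        _ = (Real.sqrt n * Real.sqrt n) * Real.log r := by ring
        _ = n * Real.log r := by rw [Real.mul_self_sqrt (Nat.cast_nonneg n)]
    have hrn : r ^ n = Real.exp (n * Real.log r) := by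
      rw [← Real.log_pow, Real.exp_log (pow_pos (by linarith) n)]
    have hkey : (1 : ℝ) ≤ x ^ n * (Real.exp (-(c * Real.sqrt n)) * connectiveConstant ^ n) :=
      calc (1 : ℝ) ≤ Real.exp (-(c * Real.sqrt n) + n * Real.log r) := Real.one_le_exp (by linarith)
        _ = Real.exp (-(c * Real.sqrt n)) * r ^ n := by rw [Real.exp_add, hrn]
        _ = x ^ n * (Real.exp (-(c * Real.sqrt n)) * connectiveConstant ^ n) := by
          rw [hr, mul_pow]; ring
    calc (1 : ℝ≥0∞)
        ≤ ENNReal.ofReal (x ^ n * (Real.exp (-(c * Real.sqrt n)) * connectiveConstant ^ n)) :=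
          ENNReal.one_le_ofReal.mpr hkey
      _ ≤ ENNReal.ofReal (x ^ n * bridgeCount n) :=
          ENNReal.ofReal_le_ofReal (mul_le_mul_of_nonneg_left (hc n).1 (pow_nonneg hx0.le n))
      _ = ENNReal.ofReal (x ^ n) * (bridgeCount n : ℝ≥0∞) := by
          rw [ENNReal.ofReal_mul (pow_nonneg hx0.le n), ENNReal.ofReal_natCast]
  by_contra hne
  have hlt : ∀ᶠ n : ℕ in atTop, ENNReal.ofReal (x ^ n) * (bridgeCount n : ℝ≥0∞) < 1 :=
    (ENNReal.tendsto_atTop_zero_of_tsum_ne_top hne).eventually_lt_const zero_lt_one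
  obtain ⟨n, h1, h2⟩ := (hev.and hlt).exists
  exact absurd h2 (not_lt.mpr h1)

/-- **The radius of finiteness of the bridge generating function is the critical fugacity**:
`sup {x ≥ 0 | ∑ₙ bₙ xⁿ < ∞} = x_c = 1/μ` (`μ_Bridge = μ`, Madras–Slade Corollary 3.1.6 with
(1.2.17)). This is the value `x(0) = x_c` of the critical curve of `FrontierTiltedSAWLaw.lean`.
[cite: MadrasSlade1993, Corollary 3.1.6] -/
theorem sSup_bridgeSeries_ne_top :
    sSup {x : ℝ | 0 ≤ x ∧ (∑' n : ℕ, ENNReal.ofReal (x ^ n) * (bridgeCount n : ℝ≥0∞)) ≠ ⊤} =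
      criticalFugacity := by
  have hxc := criticalFugacity_pos
  refine csSup_eq_of_forall_le_of_forall_lt_exists_gt ⟨0, le_rfl, ?_⟩ ?_ ?_
  · exact bridgeSeries_ne_top_of_lt_criticalFugacity le_rfl hxc
  · rintro x ⟨-, hx⟩
    by_contra hlt
    exact hx (bridgeSeries_eq_top_of_criticalFugacity_lt (not_le.mp hlt))
  · intro w hw
    refine ⟨max 0 ((w + criticalFugacity) / 2), ⟨le_max_left _ _, ?_⟩, ?_⟩
    · exact bridgeSeries_ne_top_of_lt_criticalFugacity (le_max_left _ _)
        (max_lt hxc (by linarith))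
    · exact lt_max_of_lt_right (by linarith)

end Literature.Probability.RandomPlanarGeometry.SAW
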